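import Summits.ValiantsHypothesis.ValiantsHypothesis.Theorems.NNDivisionHard.Negative.WeakReliefBlindPermutahedron
import Literature.Barriers.PneNP.TSPExtensionComplexityKaibelWeltge
import Literature.Combinatorics.Optimization.PatternMatrixRankUpperBounds

/-!
# AsymmetricWindow39 — the λ = 0 slice endpoint and λ-monotonicity of the located permutahedron pencil
# (crux `FifoMatching.NNDivisionHard`, stmt-ValiantsHypothesis-21181; W7 S2 lane, val-idea-39 g6)

S2 census object (R331 (2)(d)): the located permutahedron pencil
`M_λ[a; (b, π)] = (1 − |a ∩ b|)² + λ·inv(a; π)`, `inv(a;π) = #{(l ∈ a, l′ ∉ a) : π(l′) < π(l)}`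
(rows `a ⊆ [n]`, columns `(b, π)`), in the poly currency.  Kernel state before this file
(`Cruxes/NNDivisionHard/RealLambda39.lean` rev 6, port `…Negative.RealLambda*`): T1 `rank₊ M_λ ≤ n^{O(1/λ)}`
(blind unless `λ → 0`), T2/T3 `rank₊ M_λ ≥ 2^{Ω(min(n, λ^{-1/2}))}` (visible once `λ·log² n → 0`),
T4 symmetric certificates `n^{Θ(min(n,1/λ))}` (visible iff `λ → 0`).  The ASYMMETRIC WINDOW
`λ(n) ∈ [c/log² n, o(1)]` for general factorisations is open.

THIS FILE adds two small kernel facts that frame the window (memo `AsymmetricWindow39.md` has the analysis):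

* §1 **Sliced Kaibel–Weltge (the λ = 0 endpoint on every slice).**  Any nonnegative factorisation of
  `((1 − |a∩b|)²)` restricted to the rows `|a| = k` (all columns `b`) has at least `C(n,k)/2^k` slots
  (`choose_le_card_mul_two_pow_of_slice_block`), although its rank is `≤ 1 + n + C(n,2)` for every `k`.
  So at `λ = 0` every slice `k` is visible with the full exponent `k` (support genus); the window question is
  how fast the exponent decays from `k` (λ = 0) to `O(1/λ)` (T1) as the located flood `λ·inv` is switched on.
* §2 **Monotonicity in λ.**  `inv` is an explicit cone term with `n²` slots
  (`inv(a;π) = Σ_{l,l′} [l ∈ a][l′ ∉ a]·[π(l′) < π(l)]`), hence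
  `HasNonnegFactorization M_{λ′} r → HasNonnegFactorization M_λ (r + n²)` for `λ′ ≤ λ`
  (`pencilEntry_factorization_mono`): lower bounds transfer DOWNWARD in `λ`, upper bounds UPWARD, and the
  visibility threshold `λ*(n, r) = sup {λ : rank₊ M_λ^{(n)} > r}` is well defined up to the additive `n²`.

Statements are in the factorisation style of T3/T4 (explicit slot type `S`, factors `U, V ≥ 0`, entry
identity as hypothesis), so they apply verbatim to `RealLambda.pencil n lam` once port part 2 lands
(`pencilEntry` below is the SAME FORMULA as the port's `RealLambda.pencil`; `rfl` once part 2 lands).  Imports: landed Theorems/Literature only.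
VP ≠ VNP is NOT proved; `NNDivisionHard` stays OPEN; nothing here is an instance of `CoreLawHull`.

Theorems-side port (val-port-1 g4, desk #458/#459 hand; critic of record val-idea-crit-9 g3 V#139a KERNEL OF RECORD) of val-idea-39 g6's crux workfile
`Cruxes/NNDivisionHard/AsymmetricWindow39.lean` @4f29a1b2abda (sha16 404e3fcf456bdce2, 470 l., 24 decls): declaration texts VERBATIM, split at the §2/§3
seam for the 400-line norm into `Theorems/NNDivisionHard/Negative/AsymmetricWindowSlice.lean` (§1 sliced Kaibel–Weltge + §2 pencil/monotonicity) and
`Theorems/NNDivisionHard/Negative/AsymmetricWindowInformative.lean` (§3 informative rows; imports the first); namespace moved to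
`Summit.ValiantsHypothesis.Theorems.NNDivisionHardNegative.AsymmetricWindow` (Negative-lane convention).  S2 INSTRUMENTS (census rows S2-K1/K2/K3), helper lane;
nothing closes; `NNDivisionHard` (stmt-21181) OPEN; VP ≠ VNP NOT proved.
-/


namespace Summit.ValiantsHypothesis.Theorems.NNDivisionHardNegative.AsymmetricWindow

open Finset
open Literature.Barriers.PneNP (disjPairs mem_disjPairs IsKWValid disjPairs_filter_fst_eq)
open Literature.Combinatorics.Optimization (HasNonnegFactorization hasNonnegFactorization_of_fintype)
open Summit.ValiantsHypothesis.Theorems.NNDivisionHardNegative.BlindCubeIdentity (ind ind_nonneg ind_le_one)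
open Summit.ValiantsHypothesis.Theorems.NNDivisionHardNegative.WeakReliefBlind (inv invInd invInd_nonneg)

/-! ## §1  Sliced Kaibel–Weltge: the `k`-slice of unique disjointness needs `C(n,k)/2^k` slots -/

section SlicedKW

variable {α : Type*} [DecidableEq α]

/-- The disjoint pairs `(a, b)`, `a, b ⊆ U`, with `|a| = k` number `C(|U|, k) · 2^{|U| − k}`. -/
theorem card_disjPairs_slice (U : Finset α) (k : ℕ) :
    ((disjPairs U).filter (fun p => p.1.card = k)).card = U.card.choose k * 2 ^ (U.card - k) := by
  rw [card_eq_sum_card_fiberwise (f := Prod.fst) (t := U.powersetCard k)]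
  · have hfib : ∀ a ∈ U.powersetCard k,
        (((disjPairs U).filter (fun p => p.1.card = k)).filter (fun p => p.1 = a)).card = 2 ^ (U.card - k) := by
      intro a ha
      rw [mem_powersetCard] at ha
      have h1 : ((disjPairs U).filter (fun p => p.1.card = k)).filter (fun p => p.1 = a) =
          (disjPairs U).filter (fun p => p.1 = a) := by
        ext p
        simp only [mem_filter]
        constructor
        · rintro ⟨⟨hp, _⟩, hpa⟩; exact ⟨hp, hpa⟩
        · rintro ⟨hp, hpa⟩; exact ⟨⟨hp, hpa ▸ ha.2⟩, hpa⟩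
      rw [h1, disjPairs_filter_fst_eq ha.1, card_image_of_injective _ (fun b b' h => (Prod.ext_iff.1 h).2),
        card_powerset, card_sdiff_of_subset ha.1, ha.2]
    rw [sum_congr rfl hfib, sum_const, card_powersetCard, smul_eq_mul]
  · intro p hp
    have hp' := mem_filter.1 hp
    exact mem_powersetCard.2 ⟨(mem_disjPairs.1 hp'.1).1, hp'.2⟩

/-- **Sliced Kaibel–Weltge covering bound.**  If a family `J` of rectangles `RA j × RB j`, each free of pairs
meeting in exactly one element, covers every disjoint pair `(a, b)` of subsets of `U` with `|a| = k`, then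
`C(|U|,k) · 2^{|U|−k} ≤ |J| · 2^{|U|}`. -/
theorem choose_mul_two_pow_le_of_cover_slice {ι : Type*} (U : Finset α) (k : ℕ) (J : Finset ι)
    (RA RB : ι → Set (Finset α))
    (hfree : ∀ j ∈ J, ∀ a ∈ RA j, ∀ b ∈ RB j, (a ∩ b).card ≠ 1)
    (hcover : ∀ a b : Finset α, a ⊆ U → b ⊆ U → a.card = k → Disjoint a b →
      ∃ j ∈ J, a ∈ RA j ∧ b ∈ RB j) :
    U.card.choose k * 2 ^ (U.card - k) ≤ J.card * 2 ^ U.card := by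
  classical
  let R : ι → Finset (Finset α × Finset α) :=
    fun j => (disjPairs U).filter fun p => p.1 ∈ RA j ∧ p.2 ∈ RB j
  have hsub : (disjPairs U).filter (fun p => p.1.card = k) ⊆ J.biUnion R := by
    intro p hp
    have hp' := mem_filter.1 hp
    obtain ⟨ha, hb, hd⟩ := mem_disjPairs.1 hp'.1
    obtain ⟨j, hj, hja, hjb⟩ := hcover p.1 p.2 ha hb hp'.2 hd
    exact mem_biUnion.2 ⟨j, hj, mem_filter.2 ⟨hp'.1, hja, hjb⟩⟩
  have hR : ∀ j ∈ J, (R j).card ≤ 2 ^ U.card := by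
    intro j hj
    refine IsKWValid.card_le_two_pow U (R j) ?_ (filter_subset _ _)
    intro p hp q hq
    have hp' := (mem_filter.1 hp).2
    have hq' := (mem_filter.1 hq).2
    exact hfree j hj p.1 hp'.1 q.2 hq'.2
  calc U.card.choose k * 2 ^ (U.card - k) = ((disjPairs U).filter (fun p => p.1.card = k)).card :=
        (card_disjPairs_slice U k).symm
    _ ≤ (J.biUnion R).card := card_le_card hsub
    _ ≤ ∑ j ∈ J, (R j).card := card_biUnion_le
    _ ≤ ∑ j ∈ J, 2 ^ U.card := sum_le_sum hR
    _ = J.card * 2 ^ U.card := by rw [sum_const, smul_eq_mul]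

/-- The same bound divided through: `C(|U|, k) ≤ |J| · 2^k`. -/
theorem choose_le_card_mul_two_pow_of_cover_slice {ι : Type*} (U : Finset α) (k : ℕ) (J : Finset ι)
    (RA RB : ι → Set (Finset α))
    (hfree : ∀ j ∈ J, ∀ a ∈ RA j, ∀ b ∈ RB j, (a ∩ b).card ≠ 1)
    (hcover : ∀ a b : Finset α, a ⊆ U → b ⊆ U → a.card = k → Disjoint a b →
      ∃ j ∈ J, a ∈ RA j ∧ b ∈ RB j) :
    U.card.choose k ≤ J.card * 2 ^ k := by
  by_cases hk : k ≤ U.card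
  · have h := choose_mul_two_pow_le_of_cover_slice U k J RA RB hfree hcover
    have hpow : 2 ^ U.card = 2 ^ k * 2 ^ (U.card - k) := by rw [← pow_add, Nat.add_sub_cancel' hk]
    rw [hpow, ← mul_assoc] at h
    exact Nat.le_of_mul_le_mul_right h (Nat.pos_of_ne_zero (pow_ne_zero _ two_ne_zero))
  · rw [Nat.choose_eq_zero_of_lt (Nat.lt_of_not_le hk)]; exact Nat.zero_le _

/-- **Sliced Kaibel–Weltge, factorisation form (the λ = 0 endpoint on the slice `k`).**  A nonnegative
factorisation `Σ_s U_r(s) V_c(s)` through a finite slot type `ι` which reproduces `(1 − |a∩b|)²` on the rows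
`|a| = k` (row `row a`) against all columns `col b` has `C(|α|, k) ≤ |ι| · 2^k` — the support rectangles of the
slots are free of `|a∩b| = 1` and cover the disjoint pairs. -/
theorem choose_le_card_mul_two_pow_of_slice_block {R C ι : Type*} [Fintype ι] [Fintype α] (k : ℕ)
    (U : R → ι → ℝ) (V : C → ι → ℝ) (hU : ∀ r i, 0 ≤ U r i) (hV : ∀ c i, 0 ≤ V c i)
    (row : Finset α → R) (col : Finset α → C)
    (hblock : ∀ a b : Finset α, a.card = k → ∑ i, U (row a) i * V (col b) i = (1 - ((a ∩ b).card : ℝ)) ^ 2) :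
    (Fintype.card α).choose k ≤ Fintype.card ι * 2 ^ k := by
  classical
  have h := choose_le_card_mul_two_pow_of_cover_slice (Finset.univ : Finset α) k (Finset.univ : Finset ι)
    (fun i => {a | a.card = k ∧ 0 < U (row a) i}) (fun i => {b | 0 < V (col b) i}) ?_ ?_
  · simpa using h
  · intro i _ a ha b hb h1
    simp only [Set.mem_setOf_eq] at ha hb
    have hsum := hblock a b ha.1
    rw [h1] at hsum
    norm_num at hsum
    have hpos : 0 < ∑ i, U (row a) i * V (col b) i :=
      lt_of_lt_of_le (mul_pos ha.2 hb) (single_le_sum (fun j _ => mul_nonneg (hU _ j) (hV _ j)) (mem_univ i))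
    linarith
  · intro a b _ _ hak hab
    have hsum := hblock a b hak
    rw [disjoint_iff_inter_eq_empty.1 hab] at hsum
    norm_num at hsum
    have hex : ∃ i, 0 < U (row a) i * V (col b) i := by
      by_contra hne
      simp only [not_exists, not_lt] at hne
      have : ∑ i, U (row a) i * V (col b) i ≤ 0 := sum_nonpos fun i _ => hne i
      linarith
    obtain ⟨i, hi⟩ := hex
    have hUi : 0 < U (row a) i := by
      rcases (hU (row a) i).lt_or_eq with h | h
      · exact h
      · rw [← h, zero_mul] at hi; exact absurd hi (lt_irrefl 0)
    exact ⟨i, mem_univ i, ⟨hak, hUi⟩, pos_of_mul_pos_right hi (hU _ i)⟩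

end SlicedKW

/-! ## §2  The located pencil: entry, λ = 0 endpoint on the slices, monotonicity in λ -/

section Pencil

variable {n : ℕ}

/-- The entry of the located permutahedron pencil `M_λ[a; (b,π)] = (1 − |a∩b|)² + λ·inv(a;π)` (real-valued;
the same formula as `RealLambda.pencil n lam a (b, π)` of port part 2 — not imported here, Cruxes files import landed modules only). -/
def pencilEntry (n : ℕ) (lam : ℝ) (a : Finset (Fin n)) (bπ : Finset (Fin n) × Equiv.Perm (Fin n)) : ℝ :=
  ((1 : ℝ) - ((a ∩ bπ.1).card : ℝ)) ^ 2 + lam * (inv a bπ.2 : ℝ)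

/-- **λ = 0 endpoint on the slice `k`:** a nonnegative factorisation of `M_0` through a finite slot type `S`
which is exact on the rows `|a| = k` has `C(n,k) ≤ |S| · 2^k`.  (At `λ = 0` the column parameter `π` is idle;
the slice of unique disjointness has rank `≤ 1 + n + C(n,2)` but nonnegative rank `≥ C(n,k)/2^k`.) -/
theorem pencil_zero_slice_lower (k : ℕ) {S : Type*} [Fintype S]
    (U : Finset (Fin n) → S → ℝ) (V : Finset (Fin n) × Equiv.Perm (Fin n) → S → ℝ)
    (hU : ∀ a s, 0 ≤ U a s) (hV : ∀ bπ s, 0 ≤ V bπ s)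
    (hfac : ∀ a bπ, a.card = k → pencilEntry n 0 a bπ = ∑ s, U a s * V bπ s) :
    n.choose k ≤ Fintype.card S * 2 ^ k := by
  have h := choose_le_card_mul_two_pow_of_slice_block (α := Fin n) k U V hU hV id (fun b => (b, 1)) ?_
  · simpa using h
  · intro a b hak
    have := hfac a (b, 1) hak
    simp only [pencilEntry, zero_mul, add_zero] at this
    exact this.symm

/-- `inv(a;π)` is an explicit cone term: `inv a π = Σ_{(l,l′)} ([l ∈ a][l′ ∉ a]) · [π(l′) < π(l)]` with nonnegative
row factor `[l ∈ a][l′ ∉ a]` and nonnegative column factor `[π(l′) < π(l)]` — `n²` slots. -/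
theorem inv_cast_sum (a : Finset (Fin n)) (π : Equiv.Perm (Fin n)) :
    (inv a π : ℝ) = ∑ p : Fin n × Fin n, ((ind a p.1 : ℝ) * (1 - (ind a p.2 : ℝ))) * (invInd π p.1 p.2 : ℝ) := by
  unfold inv
  push_cast
  rw [← Finset.sum_product' (f := fun l l' => (ind a l : ℝ) * (1 - (ind a l' : ℝ)) * (invInd π l l' : ℝ))]
  rfl

/-- **Monotonicity in λ (factorisation form).**  From a nonnegative factorisation of `M_{λ′}` through `S` one gets
one of `M_λ`, `λ′ ≤ λ`, through `S ⊕ (Fin n × Fin n)`: add the `n²` cone slots of `(λ − λ′)·inv`. -/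
theorem pencilEntry_factorization_mono {lam' lam : ℝ} (hle : lam' ≤ lam) {r : ℕ}
    (h : HasNonnegFactorization (pencilEntry n lam') r) :
    HasNonnegFactorization (pencilEntry n lam) (r + Fintype.card (Fin n × Fin n)) := by
  have hinv : HasNonnegFactorization
      (fun (a : Finset (Fin n)) (bπ : Finset (Fin n) × Equiv.Perm (Fin n)) => (lam - lam') * (inv a bπ.2 : ℝ))
      (Fintype.card (Fin n × Fin n)) := by
    refine hasNonnegFactorization_of_fintype
      (fun a p => (lam - lam') * ((ind a p.1 : ℝ) * (1 - (ind a p.2 : ℝ))))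
      (fun p bπ => (invInd bπ.2 p.1 p.2 : ℝ)) ?_ ?_ ?_
    · intro a p
      have h0 : (0 : ℝ) ≤ (ind a p.1 : ℝ) := by exact_mod_cast ind_nonneg a p.1
      have h1 : (ind a p.2 : ℝ) ≤ 1 := by exact_mod_cast ind_le_one a p.2
      exact mul_nonneg (by linarith) (mul_nonneg h0 (by linarith))
    · intro p bπ
      exact_mod_cast invInd_nonneg bπ.2 p.1 p.2
    · intro a bπ
      rw [inv_cast_sum, Finset.mul_sum]
      refine Finset.sum_congr rfl fun p _ => ?_
      ring
  have hsum := h.add hinv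
  refine (show pencilEntry n lam = fun a bπ => pencilEntry n lam' a bπ + (lam - lam') * (inv a bπ.2 : ℝ) from ?_) ▸ hsum
  funext a bπ
  simp only [pencilEntry]
  ring

/-- The slot count in `pencilEntry_factorization_mono`, spelled out: `|Fin n × Fin n| = n²`. -/
theorem card_slots_sq : Fintype.card (Fin n × Fin n) = n ^ 2 := by
  simp [sq]

/-- **Monotonicity in λ, `n²` form:** `rank₊ M_λ ≤ rank₊ M_{λ′} + n²` for `λ′ ≤ λ`; equivalently every LOWER bound
`rank₊ M_λ > r + n²` transfers to `rank₊ M_{λ′} > r` for all `λ′ ≤ λ` (visibility is downward closed in `λ`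
up to `n²`), and every certificate at `λ′` is one at all `λ ≥ λ′` with `n²` more slots. -/
theorem pencilEntry_factorization_mono' {lam' lam : ℝ} (hle : lam' ≤ lam) {r : ℕ}
    (h : HasNonnegFactorization (pencilEntry n lam') r) :
    HasNonnegFactorization (pencilEntry n lam) (r + n ^ 2) := by
  have := pencilEntry_factorization_mono hle h
  rwa [card_slots_sq] at this

/-- Contrapositive bookkeeping: a lower bound at `λ` is a lower bound at every `λ′ ≤ λ`, shifted by `n²`. -/
theorem pencilEntry_lower_downward {lam' lam : ℝ} (hle : lam' ≤ lam) {r : ℕ}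
    (hlow : ¬ HasNonnegFactorization (pencilEntry n lam) (r + n ^ 2)) :
    ¬ HasNonnegFactorization (pencilEntry n lam') r :=
  fun h => hlow (pencilEntry_factorization_mono' hle h)

end Pencil

end Summit.ValiantsHypothesis.Theorems.NNDivisionHardNegative.AsymmetricWindow
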